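import Summits.HubbardSuperconductivity.HubbardSuperconductivity.Theorems.AposterioriCapRgSsbToEvenTorusLroDoubleCommBound
import HarnessLib

/-!
# Crux `WcbcsSsbToTorusLRO` (stmt-HubbardSuperconductivity-2009), line `off-zero-mode-moment-closure`:
# stub F2 `stub_pairCommutatorBudget` — the pair-commutator budget (proved)

Graded-locality bound on the SINGLE commutator `[Δ_d(m)ᴴ, Δ_d(m)]` of the momentum-`q` `d`-wave pair
field `A = pairFieldAt dWaveFormFactor L m = Σ_y conj χ_m(y) • P_y` (`pairFieldAt_eq_sum_torusChar`)
with its adjoint `Aᴴ = Σ_y χ_m(y) • P_yᴴ` (`pairFieldAt_conjTranspose`):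
`|Re⟨φ, (Aᴴ A - A Aᴴ) φ⟩| ≤ B L² ⟨φ, φ⟩` with `B = 2 s² K²`, `s = #{0, ±e₁, ±e₂}`,
`K = 2 Σ_e |d(e)/√2|`, uniformly in the momentum label `m`.

Proof (the pattern of `dcq_norm_doubleCommutator_le`, with the Hamiltonian replaced by the
identity): `Aᴴ A - A Aᴴ = Σ_x Σ_y (q'_y q_x - q_x q'_y)` with inner pieces `q_x = conj χ_m(x) • P_x`,
EVEN and localised on the `≤ s` sites `x + e`, `e ∈ {0, ±e₁, ±e₂}`, and outer pieces
`q'_y = χ_m(y) • P_yᴴ` localised on the same sets; by graded locality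
(`commute_of_mem_carEvenSubalgebra`, packaged as `dc_sum_norm_commutator_local_le`)
`[q'_y, q_x] = 0` unless the supports meet, which for fixed `x` happens for `≤ s · s` values of `y`,
and each surviving term has norm `≤ 2K²` (`‖χ_m(y)‖ = 1`, `norm_localPair_le`). Hence
`‖Aᴴ A - A Aᴴ‖ ≤ 2 s² K² L²` (`pcb_norm_commutator_pairFieldAt_le`), and the Rayleigh-quotient bound
`|Re⟨φ, Dφ⟩| ≤ ‖D‖ ⟨φ, φ⟩` (`abs_re_star_dotProduct_mulVec_le`) gives the registered quadratic-form
inequality. Koma–Tasaki 1994, proof of Theorem 2.2 (with the norm count replacing `[o_x, o_y] = 0`,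
which fails for overlapping bond pairs).
-/

noncomputable section

set_option linter.dupNamespace false

namespace Summit.HubbardSuperconductivity.HubbardSuperconductivity.Theorems.WcbcsSsbToTorusLRO

open Literature.MathematicalPhysics.QuantumLattice Literature.Probability.LatticeModels Matrix
open scoped ComplexOrder ComplexConjugate Matrix.Norms.L2Operator

/-! ### Graded locality on a general finite set of sites: the two-family single commutator -/

section General

variable {Λ : Type*} [LinearOrder Λ] [Fintype Λ]

/-- **The two-family single-commutator bound, general form.** Let `q_y` (`y : κ`) be EVEN
observables localised on site sets `V y` of size `≤ s`, and `q'_y` observables localised on the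
same sets, with `‖q_y‖, ‖q'_y‖ ≤ M`, such that every set `A` of sites meets `V y` for at most
`|A| · s` values of `y`. Then for `O = Σ_y q_y` and `O' = Σ_y q'_y`,
`‖O' O - O O'‖ ≤ 2 |κ| s² M²`: `[O', O] = Σ_x Σ_y [q'_y, q_x]`, and for fixed `x` the `y`-sum has
`≤ s · s` non-zero terms (graded locality, Bratteli–Robinson II §5.2.2), each of norm `≤ 2M ‖q_x‖`.
Koma–Tasaki 1994, proof of Theorem 2.2 (there with commuting `o_x`); the double-commutator version
is `dcq_norm_doubleCommutator_le`. [cite: KomaTasaki1994, Theorem 2.2] -/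
theorem pcb_norm_commutator_sum_le {s : ℕ} {κ : Type*} [Fintype κ] (V : κ → Finset Λ)
    (q q' : κ → Matrix (Finset (Orb Λ)) (Finset (Orb Λ)) ℂ)
    (hq : ∀ y, q y ∈ carEvenSubalgebra (orbSet (V y)))
    (hq' : ∀ y, q' y ∈ carSubalgebra (orbSet (V y)))
    {M : ℝ} (hM0 : 0 ≤ M) (hM : ∀ y, ‖q y‖ ≤ M) (hM' : ∀ y, ‖q' y‖ ≤ M)
    (hV : ∀ y, (V y).card ≤ s)
    (hN : ∀ A : Finset Λ, (Finset.univ.filter fun y => ¬ Disjoint A (V y)).card ≤ A.card * s) :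
    ‖(∑ y, q' y) * (∑ y, q y) - (∑ y, q y) * ∑ y, q' y‖ ≤
      2 * Fintype.card κ * (s : ℝ) ^ 2 * M ^ 2 := by
  -- adapted from `dcq_norm_doubleCommutator_le` (the Hamiltonian replaced by the identity)
  -- Step 1: expand `[O', O] = Σ_x Σ_y [q'_y, q_x]`
  have hexp : (∑ y, q' y) * (∑ x, q x) - (∑ x, q x) * ∑ y, q' y =
      ∑ x, ∑ y, (q' y * q x - q x * q' y) := by
    rw [dc_commutator_finset_sum]
    exact Finset.sum_congr rfl fun x _ => finset_sum_commutator _ _ _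
  rw [hexp]
  -- Step 2: the `y`-sum, for fixed `x` (graded locality of the OUTER family against `q_x`)
  have hF : ∀ x, ∑ y, ‖q' y * q x - q x * q' y‖ ≤ ((s * s : ℕ) : ℝ) * (2 * M * M) := by
    intro x
    refine (dc_sum_norm_commutator_local_le V q' hq' hM' (hq x)).trans ?_
    have hcard : (Finset.univ.filter fun y => ¬ Disjoint (V x) (V y)).card ≤ s * s :=
      (hN _).trans (Nat.mul_le_mul_right _ (hV x))
    have hcard' : ((Finset.univ.filter fun y => ¬ Disjoint (V x) (V y)).card : ℝ) ≤
        ((s * s : ℕ) : ℝ) := by exact_mod_cast hcard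
    have hnn : 0 ≤ 2 * M * ‖q x‖ := by positivity
    refine (mul_le_mul_of_nonneg_right hcard' hnn).trans ?_
    gcongr
    exact hM x
  -- Step 3: assemble
  calc ‖∑ x, ∑ y, (q' y * q x - q x * q' y)‖
      ≤ ∑ x, ‖∑ y, (q' y * q x - q x * q' y)‖ := norm_sum_le _ _
    _ ≤ ∑ x, ∑ y, ‖q' y * q x - q x * q' y‖ := Finset.sum_le_sum fun x _ => norm_sum_le _ _
    _ ≤ ∑ _x : κ, ((s * s : ℕ) : ℝ) * (2 * M * M) := Finset.sum_le_sum fun x _ => hF x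
    _ = 2 * Fintype.card κ * (s : ℝ) ^ 2 * M ^ 2 := by
        rw [Finset.sum_const, Finset.card_univ, nsmul_eq_mul]
        push_cast
        ring

end General

/-! ### Specialisation to the momentum-`q` pair field on the torus -/

section Torus

variable (g : Site 2 → ℝ) (L : ℕ) [NeZero L]

/-- **The single-commutator bound for the momentum-`q` pair field on the torus**, for every form
factor `g` and momentum label `m`: with `A = Δ_g(m) = Σ_x conj χ_m(x) P_x` on `(ℤ/Lℤ)²`,
`s = #{0, ±e₁, ±e₂}` and `K = 2 Σ_e |g e/√2|`, `‖Aᴴ A - A Aᴴ‖ ≤ 2 s² K² L²` — the two-family bound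
`pcb_norm_commutator_sum_le` with inner pieces `conj χ_m(y) • P_y` and outer pieces `χ_m(y) • P_yᴴ`,
both localised on the `≤ 5` sites `y + e` and of norm `≤ K` (`‖χ_m(y)‖ = 1`). As in
`dcq_norm_doubleCommutator_pairFieldAt_le`, the statement is made for an ARBITRARY
`DecidableEq (FermionTorus 2 L)` instance (on which the `L²`-operator norm depends syntactically)
and the proof substitutes `LinearOrder.toDecidableEq`. [cite: KomaTasaki1994, Theorem 2.2] -/
theorem pcb_norm_commutator_pairFieldAt_le (m : TorusSite 2 L) [inst : DecidableEq (FermionTorus 2 L)] :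
    ‖(pairFieldAt g L m)ᴴ * pairFieldAt g L m - pairFieldAt g L m * (pairFieldAt g L m)ᴴ‖ ≤
      2 * ((insert (0 : Site 2) unitSteps).card : ℝ) ^ 2 *
        (2 * ∑ e ∈ insert (0 : Site 2) unitSteps, |g e / Real.sqrt 2|) ^ 2 * (L : ℝ) ^ 2 := by
  -- adapted from `dcq_norm_doubleCommutator_pairFieldAt_le` (same families, supports and counting)
  have hinst : inst = LinearOrder.toDecidableEq := Subsingleton.elim _ _
  subst hinst
  letI hdec : DecidableEq (FermionTorus 2 L) := LinearOrder.toDecidableEq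
  set S : Finset (Site 2) := insert 0 unitSteps with hS_def
  set K : ℝ := 2 * ∑ e ∈ S, |g e / Real.sqrt 2| with hK_def
  -- the local pieces `q_y = conj χ_m(y) • P_y` of `Δ_g(m)`, `q'_y = χ_m(y) • P_yᴴ` of `Δ_g(m)ᴴ`,
  -- and their common supports
  set q : TorusSite 2 L → Matrix (Finset (Orb (FermionTorus 2 L))) (Finset (Orb (FermionTorus 2 L))) ℂ :=
    fun y => conj (torusChar m y) • localPair g L y with hq_def
  set q' : TorusSite 2 L → Matrix (Finset (Orb (FermionTorus 2 L))) (Finset (Orb (FermionTorus 2 L))) ℂ :=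
    fun y => torusChar m y • (localPair g L y)ᴴ with hq'_def
  set V : TorusSite 2 L → Finset (FermionTorus 2 L) :=
    fun y => S.image fun e => FermionTorus.ofTorusSite (y + Torus.proj L e) with hV_def
  have hyV : ∀ y, FermionTorus.ofTorusSite y ∈ V y := fun y => by
    have h0 : Torus.proj L (0 : Site 2) = 0 := funext fun i => by simp
    exact Finset.mem_image.2 ⟨0, Finset.mem_insert_self _ _, by rw [h0, add_zero]⟩
  have heV : ∀ y, ∀ e ∈ S, FermionTorus.ofTorusSite (y + Torus.proj L e) ∈ V y := fun y e he =>
    Finset.mem_image_of_mem _ he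
  have hq : ∀ y, q y ∈ carEvenSubalgebra (orbSet (V y)) := fun y => by
    simp only [hq_def]
    rw [Literature.Barriers.HubbardSuperconductivity.localPair_eq_sum_bondPair]
    exact Subalgebra.smul_mem _ (Subalgebra.sum_mem _ fun e he =>
      Subalgebra.smul_mem _ (dc_bondPair_mem_carEvenSubalgebra (hyV y) (heV y e he)) _) _
  have hq' : ∀ y, q' y ∈ carSubalgebra (orbSet (V y)) := fun y => by
    refine carEvenSubalgebra_le_carSubalgebra _ ?_
    simp only [hq'_def]
    rw [Literature.Barriers.HubbardSuperconductivity.localPair_eq_sum_bondPair, conjTranspose_sum]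
    refine Subalgebra.smul_mem _ (Subalgebra.sum_mem _ fun e he => ?_) _
    rw [conjTranspose_smul]
    exact Subalgebra.smul_mem _
      (dc_bondPair_conjTranspose_mem_carEvenSubalgebra (hyV y) (heV y e he)) _
  have hM : ∀ y, ‖q y‖ ≤ K := fun y => by
    simp only [hq_def]
    rw [norm_smul, Complex.norm_conj, norm_torusChar, one_mul]
    exact norm_localPair_le g L y
  have hM' : ∀ y, ‖q' y‖ ≤ K := fun y => by
    simp only [hq'_def]
    rw [norm_smul, norm_torusChar, one_mul, l2_opNorm_conjTranspose]
    exact norm_localPair_le g L y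
  have hV : ∀ y, (V y).card ≤ S.card := fun y => Finset.card_image_le
  have hA' : (pairFieldAt g L m)ᴴ = ∑ y, q' y := pairFieldAt_conjTranspose g L m
  have hA : pairFieldAt g L m = ∑ y, q y := pairFieldAt_eq_sum_torusChar g L m
  have key := pcb_norm_commutator_sum_le (s := S.card) V q q' hq hq' (M := K)
    (by positivity) hM hM' hV ?_
  · rw [hA', hA]
    refine key.trans (le_of_eq ?_)
    rw [card_torusSite_two]
    push_cast
    ring
  · -- counting: `A` meets `V y` only for `y = w - e`, `w ∈ A`, `e ∈ S`
    -- (the subset is taken from the goal, whose decidability instances are the generic ones)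
    intro A
    refine (Finset.card_le_card (t := A.biUnion fun w => S.image fun e =>
      FermionTorus.toTorusSite w - Torus.proj L e) fun y hy => ?_).trans ?_
    · rw [Finset.mem_filter] at hy
      obtain ⟨w, hwA, hwV⟩ := Finset.not_disjoint_iff.1 hy.2
      obtain ⟨e, he, hwe⟩ := Finset.mem_image.1 hwV
      refine Finset.mem_biUnion.2 ⟨w, hwA, Finset.mem_image.2 ⟨e, he, ?_⟩⟩
      rw [← hwe, FermionTorus.toTorusSite_ofTorusSite, add_sub_cancel_right]
    · calc (A.biUnion fun w => S.image fun e => FermionTorus.toTorusSite w - Torus.proj L e).card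
          ≤ ∑ w ∈ A, (S.image fun e => FermionTorus.toTorusSite w - Torus.proj L e).card :=
            Finset.card_biUnion_le
        _ ≤ ∑ _w ∈ A, S.card := Finset.sum_le_sum fun w _ => Finset.card_image_le
        _ = A.card * S.card := by rw [Finset.sum_const, smul_eq_mul]

end Torus

/-! ### The stub -/

/-- **Stub F2 — `stub_pairCommutatorBudget`** of the line `off-zero-mode-moment-closure` (crux
`WcbcsSsbToTorusLRO`): the single commutator of the momentum-`q` `d`-wave pair field
`A = Δ_d(m)` with its adjoint is a sum of `O(L²)` bounded local terms (`[P_yᴴ, P_x] = 0` unless the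
five-site supports of `P_x`, `P_y` meet — graded locality; the phases `χ_m` have modulus one), hence
the quadratic-form bound `|Re⟨φ, (Aᴴ A - A Aᴴ) φ⟩| ≤ B L² ⟨φ, φ⟩` with `B = 2 s² K²`
(`s = #{0, ±e₁, ±e₂}`, `K = 2 Σ_e |d(e)/√2|`) independent of `L` and `m`: the operator-norm bound
`pcb_norm_commutator_pairFieldAt_le` turned into the quadratic-form bound by
`|Re⟨φ, Dφ⟩| ≤ ‖D‖ ⟨φ, φ⟩` (`abs_re_star_dotProduct_mulVec_le`). Koma–Tasaki 1994, proof of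
Theorem 2.2 (with the norm count replacing `[o_x, o_y] = 0`). [cite: KomaTasaki1994, Theorem 2.2] -/
theorem stub_pairCommutatorBudget :
    ∃ B : ℝ, 0 ≤ B ∧ ∀ (L : ℕ) [NeZero L] (m : TorusSite 2 L) (φ : Fock (Orb (FermionTorus 2 L))), |(star φ ⬝ᵥ (((pairFieldAt dWaveFormFactor L m)ᴴ * pairFieldAt dWaveFormFactor L m - pairFieldAt dWaveFormFactor L m * (pairFieldAt dWaveFormFactor L m)ᴴ) *ᵥ φ)).re| ≤ B * (L : ℝ) ^ 2 * (star φ ⬝ᵥ φ).re := by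
  set s : ℕ := (insert (0 : Site 2) unitSteps).card with hs_def
  set K : ℝ := 2 * ∑ e ∈ insert (0 : Site 2) unitSteps, |dWaveFormFactor e / Real.sqrt 2|
    with hK_def
  refine ⟨2 * (s : ℝ) ^ 2 * K ^ 2, by positivity, fun L _ m φ => ?_⟩
  set A := pairFieldAt dWaveFormFactor L m with hA_def
  have hnorm : ‖Aᴴ * A - A * Aᴴ‖ ≤ 2 * (s : ℝ) ^ 2 * K ^ 2 * (L : ℝ) ^ 2 :=
    pcb_norm_commutator_pairFieldAt_le dWaveFormFactor L m
  have hray := abs_re_star_dotProduct_mulVec_le (Aᴴ * A - A * Aᴴ) φ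
  have hφ : 0 ≤ (star φ ⬝ᵥ φ).re := (Complex.nonneg_iff.1 (dotProduct_star_self_nonneg φ)).1
  calc |(star φ ⬝ᵥ ((Aᴴ * A - A * Aᴴ) *ᵥ φ)).re|
      ≤ ‖Aᴴ * A - A * Aᴴ‖ * (star φ ⬝ᵥ φ).re := hray
    _ ≤ 2 * (s : ℝ) ^ 2 * K ^ 2 * (L : ℝ) ^ 2 * (star φ ⬝ᵥ φ).re :=
        mul_le_mul_of_nonneg_right hnorm hφ

end Summit.HubbardSuperconductivity.HubbardSuperconductivity.Theorems.WcbcsSsbToTorusLRO
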